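import Summits.Ventures.HodgeRepro2.T5DecompositionOrder
import Summits.Ventures.HodgeRepro2.T5ConjugationDecomposition

/-!
# T5ConjugationRestriction — the involution of `Gal(E/ℚ)` IS the conjugation of `E/F⁺`

Seat p3 of the blind cell `pub-hodge-repro2` (Tier-5 support column for sub-step N2 of
`route/TIER5.md`).  The one reading left as prose by `T5ConjugationDecomposition` (which takes
«`σ ≠ 1` in `Gal(E/F⁺)`») and `T5DecompositionOrder` (which takes «`c` of order `2` in the cyclic
`Gal(E/ℚ)`») is their identification, T4A §3.2's «`c = g³`».  Here it is made: for `E` Galois over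
`ℚ` with `Gal(E/ℚ)` cyclic, `c` its involution and `F` an intermediate field with `[E : F] = 2`,

* `c` fixes `F` pointwise (`mem_fixingSubgroup`): the fixing subgroup of `F` has two elements
  (`IsGalois.card_fixingSubgroup_eq_finrank`) and a subgroup of even order of a cyclic group
  contains the involution (`T5DecompositionOrder.mem_iff_two_dvd_card`);
* hence `c` restricts to the non-trivial element `conjRestrict` of `Gal(E/F)`
  (`IntermediateField.fixingSubgroupEquiv`), acting on `𝓞 E` and on its ideals exactly as `c` does;
* so, for a prime `P` of `𝓞 E`: `c • P = P` iff `c` lies in the decomposition group of `P` iff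
  `w = P ∩ 𝓞 F` is non-split in `E` (`conj_smul_eq_iff`, `conj_mem_stabilizer_iff_ncard_primesOver_eq_one`)
  — row N2.2.5's «`w` non-split in `E` iff `c ∈ D_p`» with `c ∈ Gal(E/ℚ)` itself.

Declaration of README §8(d): this file uses an L-value-free non-vanishing device: NO.
-/

namespace Summit.Ventures.HodgeRepro2.T5ConjugationRestriction

open NumberField Ideal
open scoped Pointwise

variable {E : Type*} [Field E] [NumberField E] [IsGalois ℚ E] [IsCyclic Gal(E/ℚ)]
  {c : Gal(E/ℚ)} (hc : orderOf c = 2) (F : IntermediateField ℚ E) (hFE : Module.finrank F E = 2)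

include hc hFE in
/-- **The involution fixes the index-two subfield pointwise.** -/
theorem mem_fixingSubgroup : c ∈ F.fixingSubgroup := by
  rw [T5DecompositionOrder.mem_iff_two_dvd_card hc, IsGalois.card_fixingSubgroup_eq_finrank, hFE]

/-- The involution `c` restricted to an `F`-automorphism of `E`: the conjugation of `E/F`. -/
noncomputable def conjRestrict : Gal(E/F) :=
  F.fixingSubgroupEquiv ⟨c, mem_fixingSubgroup hc F hFE⟩

/-- `conjRestrict` acts on `E` as `c`. -/
theorem conjRestrict_apply (x : E) : conjRestrict hc F hFE x = c x := rfl

include hc hFE in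
/-- `conjRestrict` is not the identity. -/
theorem conjRestrict_ne_one : conjRestrict hc F hFE ≠ 1 := by
  intro h
  have hc1 : c = 1 := by
    ext x
    have := congrArg (fun σ : Gal(E/F) => σ x) h
    simpa [conjRestrict_apply] using this
  rw [hc1, orderOf_one] at hc
  exact absurd hc (by norm_num)

/-- `conjRestrict` acts on `𝓞 E` as `c`. -/
theorem conjRestrict_smul (x : 𝓞 E) : conjRestrict hc F hFE • x = c • x := rfl

/-- `conjRestrict` acts on ideals of `𝓞 E` as `c`. -/
theorem conjRestrict_smul_ideal (P : Ideal (𝓞 E)) : conjRestrict hc F hFE • P = c • P := by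
  rw [Ideal.pointwise_smul_def, Ideal.pointwise_smul_def]
  congr 1

include hc hFE in
/-- **«`c • P = P` iff `w` is non-split in `E`»**, for the involution `c` of `Gal(E/ℚ)` itself. -/
theorem conj_smul_eq_iff (P : Ideal (𝓞 E)) [P.IsPrime] :
    c • P = P ↔ ((P.under (𝓞 F)).primesOver (𝓞 E)).ncard = 1 := by
  rw [← conjRestrict_smul_ideal hc F hFE]
  exact T5ConjugationDecomposition.smul_eq_iff_ncard_primesOver_eq_one hFE
    (conjRestrict_ne_one hc F hFE) P

include hc hFE in
/-- **«`c ∈ D_P` iff `w` is non-split in `E`»** (row N2.2.5's first link, with `D_P` the stabiliser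
of `P` in `Gal(E/ℚ)`). -/
theorem conj_mem_stabilizer_iff_ncard_primesOver_eq_one (P : Ideal (𝓞 E)) [P.IsPrime] :
    c ∈ MulAction.stabilizer Gal(E/ℚ) P ↔ ((P.under (𝓞 F)).primesOver (𝓞 E)).ncard = 1 := by
  rw [MulAction.mem_stabilizer_iff]
  exact conj_smul_eq_iff hc F hFE P

end Summit.Ventures.HodgeRepro2.T5ConjugationRestriction
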